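import Summits.Schanuel.Schanuel.Theorems.ZilberEacCancellingFixedPoint
import Mathlib.Analysis.SpecialFunctions.Exp
import Mathlib.Analysis.Calculus.MeanValue
import Mathlib.Analysis.Complex.Exponential
import Mathlib.Analysis.Complex.ExponentialBounds
import HarnessLib

/-!
# Tools for the double-cancelling regime: the Lipschitz fixed point and exponential sums

Zilber's Exponential-Algebraic Closedness, case ladder (host summit Schanuel, cell `pub-schanuel`,
seat 2, gen 15).  Quantitative companions of `ZilberEacCancellingFixedPoint` and of the fibre
terms `wⱼ(x₂) = Σᵢ A_{j,i} y₂^{i+1}`, `y₂ = S₀e^{v/e₀}`, needed to feed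
`exists_zero_of_perturbed_implicit` (`ZilberEacPerturbedImplicit`) in the double-cancelling regime
(HANDOFF O59 PLAN): there the perturbation is `Δ(v) = −μ Σⱼ rⱼ ψ(e^{−wⱼ(x₂(v))})`, and one needs
`‖Δ‖` and `Lip Δ` super-exponentially small on a ball where `Re wⱼ ≥ M`.

* **`exists_cancellingFixedPoint_lipschitz`** — a radius `η > 0` on which the cancelling fixed point
  `ψ` (`ψ(ε) = εe^{ψ(ε)}`) satisfies `‖ψ(ε)‖ ≤ 2‖ε‖`, solves `e^{x} = x + w` for `x = −w + ψ(e^{−w})`,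
  and is `6`-Lipschitz.
* **`hasDerivAt_expSum`**, **`norm_deriv_expSum_le`** — `W(v) = Σ_{i<e} Bᵢ e^{(i+1)v/e₀}` and
  `‖W′(v)‖ ≤ 3 Σ‖Bᵢ‖` for `‖v‖ ≤ 1` (`e ≤ e₀`).
* **`re_expSum_ge`** — `Re W(v) ≥ Re B_{e−1} − 2δ‖B_{e−1}‖ − 3 Σ_{i<e−1} ‖Bᵢ‖` for `‖v‖ ≤ δ ≤ 1`.
* **`norm_exp_neg_sub_le`** — if `Re W ≥ M` and `‖W′‖ ≤ B` on a convex set then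
  `v ↦ e^{−W(v)}` is bounded by `e^{−M}` and `Be^{−M}`-Lipschitz there (mean value inequality).

HONEST FRAMING: elementary estimates serving explicit families inside the OPEN cell `EC(3,2)`;
NOT Schanuel's conjecture; EAC ⇏ SC.
-/

noncomputable section

open Complex Filter Topology Metric Set

set_option linter.dupNamespace false

namespace Summit.Schanuel.Schanuel.Theorems

section FixedPoint

/-- **The cancelling fixed point, quantitative.**  A radius `η > 0` such that for `‖ε‖ < η`:
`ψ(ε) = εe^{ψ(ε)}`, `‖ψ(ε)‖ ≤ 2‖ε‖`, `e^{−w + ψ(ε)} = (−w + ψ(ε)) + w` whenever `e^{−w} = ε`, and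
`‖ψ(ε) − ψ(ε′)‖ ≤ 6‖ε − ε′‖`. (new) -/
theorem exists_cancellingFixedPoint_lipschitz :
    ∃ (ψ : ℂ → ℂ) (η : ℝ), 0 < η ∧
      (∀ ε : ℂ, ‖ε‖ < η → ψ ε = ε * exp (ψ ε) ∧ ‖ψ ε‖ ≤ 2 * ‖ε‖) ∧
      (∀ ε : ℂ, ‖ε‖ < η → ∀ w : ℂ, exp (-w) = ε → exp (-w + ψ ε) = (-w + ψ ε) + w) ∧
      (∀ ε ε' : ℂ, ‖ε‖ < η → ‖ε'‖ < η → ‖ψ ε - ψ ε'‖ ≤ 6 * ‖ε - ε'‖) := by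
  obtain ⟨ψ, -, hfix, hnorm, hsol⟩ := exists_cancellingFixedPoint
  obtain ⟨η₀, hη₀, hall⟩ := Metric.eventually_nhds_iff.1 (hfix.and (hnorm.and hsol))
  set η : ℝ := min η₀ (1 / 12) with hη
  have hηpos : 0 < η := lt_min hη₀ (by norm_num)
  have hηle : η ≤ η₀ := min_le_left _ _
  have hη12 : η ≤ 1 / 12 := min_le_right _ _
  have hP : ∀ ε : ℂ, ‖ε‖ < η → ψ ε = ε * exp (ψ ε) ∧ ‖ψ ε‖ ≤ 2 * ‖ε‖ ∧
      ∀ w : ℂ, exp (-w) = ε → exp (-w + ψ ε) = (-w + ψ ε) + w := by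
    intro ε hε
    have := hall (by rw [dist_zero_right]; exact lt_of_lt_of_le hε hηle)
    exact ⟨this.1, this.2.1, this.2.2⟩
  refine ⟨ψ, η, hηpos, fun ε hε => ⟨(hP ε hε).1, (hP ε hε).2.1⟩, fun ε hε => (hP ε hε).2.2, ?_⟩
  intro ε ε' hε hε'
  obtain ⟨hf, hn, -⟩ := hP ε hε
  obtain ⟨hf', hn', -⟩ := hP ε' hε'
  have ha : ‖ψ ε‖ < 1 / 6 := by linarith [norm_nonneg ε]
  have hb : ‖ψ ε'‖ < 1 / 6 := by linarith [norm_nonneg ε']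
  -- `ψε − ψε' = (ε − ε') e^{ψε} + ε' (e^{ψε} − e^{ψε'})`
  have hid : ψ ε - ψ ε' = (ε - ε') * exp (ψ ε) + ε' * (exp (ψ ε) - exp (ψ ε')) := by
    rw [show (ε - ε') * exp (ψ ε) + ε' * (exp (ψ ε) - exp (ψ ε')) =
      ε * exp (ψ ε) - ε' * exp (ψ ε') by ring, ← hf, ← hf']
  have hexp1 : ‖exp (ψ ε)‖ ≤ 3 := by
    rw [Complex.norm_exp]
    calc Real.exp (ψ ε).re ≤ Real.exp 1 :=
          Real.exp_le_exp.2 ((Complex.re_le_norm _).trans (by linarith))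
      _ ≤ 3 := by linarith [Real.exp_one_lt_d9]
  have hexp2 : ‖exp (ψ ε')‖ ≤ 3 := by
    rw [Complex.norm_exp]
    calc Real.exp (ψ ε').re ≤ Real.exp 1 :=
          Real.exp_le_exp.2 ((Complex.re_le_norm _).trans (by linarith))
      _ ≤ 3 := by linarith [Real.exp_one_lt_d9]
  have hdiff : ‖exp (ψ ε) - exp (ψ ε')‖ ≤ 6 * ‖ψ ε - ψ ε'‖ := by
    have hlt : ‖ψ ε - ψ ε'‖ < 1 := by
      calc ‖ψ ε - ψ ε'‖ ≤ ‖ψ ε‖ + ‖ψ ε'‖ := norm_sub_le _ _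
        _ < 1 := by linarith
    have h := Complex.locally_lipschitz_exp zero_le_one le_rfl (ψ ε') (ψ ε) hlt
    calc ‖exp (ψ ε) - exp (ψ ε')‖ ≤ (1 + 1) * ‖exp (ψ ε')‖ * ‖ψ ε - ψ ε'‖ := h
      _ ≤ (1 + 1) * 3 * ‖ψ ε - ψ ε'‖ := by gcongr
      _ = 6 * ‖ψ ε - ψ ε'‖ := by ring
  have hε'small : ‖ε'‖ ≤ 1 / 12 := le_trans hε'.le hη12
  have hmain : ‖ψ ε - ψ ε'‖ ≤ 3 * ‖ε - ε'‖ + (1 / 2) * ‖ψ ε - ψ ε'‖ := by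
    calc ‖ψ ε - ψ ε'‖ = ‖(ε - ε') * exp (ψ ε) + ε' * (exp (ψ ε) - exp (ψ ε'))‖ := by rw [hid]
      _ ≤ ‖(ε - ε') * exp (ψ ε)‖ + ‖ε' * (exp (ψ ε) - exp (ψ ε'))‖ := norm_add_le _ _
      _ = ‖ε - ε'‖ * ‖exp (ψ ε)‖ + ‖ε'‖ * ‖exp (ψ ε) - exp (ψ ε')‖ := by
          rw [norm_mul, norm_mul]
      _ ≤ ‖ε - ε'‖ * 3 + (1 / 12) * (6 * ‖ψ ε - ψ ε'‖) := by
          gcongr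
      _ = 3 * ‖ε - ε'‖ + (1 / 2) * ‖ψ ε - ψ ε'‖ := by ring
  linarith

end FixedPoint

section ExpSum

/-- The exponential sum `W(v) = Σ_{i<e} Bᵢ e^{(i+1)v/e₀}` has derivative
`Σ_{i<e} Bᵢ ((i+1)/e₀) e^{(i+1)v/e₀}`. [folklore] -/
theorem hasDerivAt_expSum (B : ℕ → ℂ) (e e₀ : ℕ) (v : ℂ) :
    HasDerivAt (fun v : ℂ => ∑ i ∈ Finset.range e, B i * exp ((((i : ℕ) : ℂ) + 1) * v / (e₀ : ℂ)))
      (∑ i ∈ Finset.range e, B i * (((((i : ℕ) : ℂ) + 1) / (e₀ : ℂ)) *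
        exp ((((i : ℕ) : ℂ) + 1) * v / (e₀ : ℂ)))) v := by
  refine HasDerivAt.fun_sum fun i _ => ?_
  have hlin : HasDerivAt (fun v : ℂ => (((i : ℕ) : ℂ) + 1) * v / (e₀ : ℂ))
      ((((i : ℕ) : ℂ) + 1) / (e₀ : ℂ)) v := by
    have := ((hasDerivAt_id v).const_mul (((i : ℕ) : ℂ) + 1)).div_const (e₀ : ℂ)
    simpa using this
  have := hlin.cexp.const_mul (B i)
  refine this.congr_deriv ?_
  ring

/-- `‖W′(v)‖ ≤ 3 Σ ‖Bᵢ‖` for `‖v‖ ≤ 1` when `e ≤ e₀`, `1 ≤ e₀`. [folklore] -/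
theorem norm_deriv_expSum_le (B : ℕ → ℂ) {e e₀ : ℕ} (he : e ≤ e₀) (he₀ : 1 ≤ e₀) {v : ℂ}
    (hv : ‖v‖ ≤ 1) :
    ‖∑ i ∈ Finset.range e, B i * (((((i : ℕ) : ℂ) + 1) / (e₀ : ℂ)) *
        exp ((((i : ℕ) : ℂ) + 1) * v / (e₀ : ℂ)))‖ ≤ 3 * ∑ i ∈ Finset.range e, ‖B i‖ := by
  have he₀pos : (0 : ℝ) < e₀ := by exact_mod_cast he₀
  rw [Finset.mul_sum]
  refine (norm_sum_le _ _).trans (Finset.sum_le_sum fun i hi => ?_)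
  have hi : i < e := Finset.mem_range.1 hi
  have hci : ‖((((i : ℕ) : ℂ) + 1) / (e₀ : ℂ))‖ ≤ 1 := by
    rw [norm_div, Complex.norm_natCast, show (((i : ℕ) : ℂ) + 1) = ((i + 1 : ℕ) : ℂ) by push_cast; ring,
      Complex.norm_natCast, div_le_one he₀pos]
    exact_mod_cast (by omega : i + 1 ≤ e₀)
  have hexp : ‖exp ((((i : ℕ) : ℂ) + 1) * v / (e₀ : ℂ))‖ ≤ 3 := by
    rw [Complex.norm_exp]
    have hre : ((((i : ℕ) : ℂ) + 1) * v / (e₀ : ℂ)).re ≤ 1 := by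
      refine (Complex.re_le_norm _).trans ?_
      rw [mul_div_right_comm, norm_mul]
      calc ‖(((i : ℕ) : ℂ) + 1) / (e₀ : ℂ)‖ * ‖v‖ ≤ 1 * 1 :=
            mul_le_mul hci hv (norm_nonneg _) zero_le_one
        _ = 1 := one_mul _
    calc Real.exp _ ≤ Real.exp 1 := Real.exp_le_exp.2 hre
      _ ≤ 3 := by linarith [Real.exp_one_lt_d9]
  rw [norm_mul, norm_mul]
  calc ‖B i‖ * (‖(((i : ℕ) : ℂ) + 1) / (e₀ : ℂ)‖ * ‖exp ((((i : ℕ) : ℂ) + 1) * v / (e₀ : ℂ))‖)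
      ≤ ‖B i‖ * (1 * 3) := by
        refine mul_le_mul_of_nonneg_left ?_ (norm_nonneg _)
        exact mul_le_mul hci hexp (norm_nonneg _) zero_le_one
    _ = 3 * ‖B i‖ := by ring

/-- **Real part of the exponential sum near `v = 0`.**  For `‖v‖ ≤ δ ≤ 1`, `1 ≤ e ≤ e₀`:
`Re W(v) ≥ Re B_{e−1} − 2δ‖B_{e−1}‖ − 3 Σ_{i<e−1} ‖Bᵢ‖`. [folklore] -/
theorem re_expSum_ge (B : ℕ → ℂ) {e e₀ : ℕ} (he1 : 1 ≤ e) (he : e ≤ e₀) {δ : ℝ} (hδ1 : δ ≤ 1)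
    {v : ℂ} (hv : ‖v‖ ≤ δ) :
    (B (e - 1)).re - 2 * δ * ‖B (e - 1)‖ - 3 * ∑ i ∈ Finset.range (e - 1), ‖B i‖ ≤
      (∑ i ∈ Finset.range e, B i * exp ((((i : ℕ) : ℂ) + 1) * v / (e₀ : ℂ))).re := by
  have he₀ : 1 ≤ e₀ := he1.trans he
  have he₀pos : (0 : ℝ) < e₀ := by exact_mod_cast he₀
  have hδ0 : 0 ≤ δ := (norm_nonneg v).trans hv
  have hv1 : ‖v‖ ≤ 1 := hv.trans hδ1
  rw [show Finset.range e = Finset.range (e - 1 + 1) by rw [Nat.sub_add_cancel he1],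
    Finset.sum_range_succ, Complex.add_re]
  -- the top term
  set c : ℂ := (((e - 1 : ℕ) : ℂ) + 1) * v / (e₀ : ℂ) with hc
  have hcn : ‖c‖ ≤ δ := by
    rw [hc, mul_div_right_comm, norm_mul]
    have h1 : ‖(((e - 1 : ℕ) : ℂ) + 1) / (e₀ : ℂ)‖ ≤ 1 := by
      rw [norm_div, show (((e - 1 : ℕ) : ℂ) + 1) = ((e - 1 + 1 : ℕ) : ℂ) by push_cast; ring,
        Complex.norm_natCast, Complex.norm_natCast, div_le_one he₀pos]
      exact_mod_cast (by omega : e - 1 + 1 ≤ e₀)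
    calc _ ≤ 1 * δ := mul_le_mul h1 hv (norm_nonneg _) zero_le_one
      _ = δ := one_mul _
  have htop : (B (e - 1)).re - 2 * δ * ‖B (e - 1)‖ ≤ (B (e - 1) * exp c).re := by
    have hsplit : B (e - 1) * exp c = B (e - 1) + B (e - 1) * (exp c - 1) := by ring
    rw [hsplit, Complex.add_re]
    have hbd : ‖B (e - 1) * (exp c - 1)‖ ≤ 2 * δ * ‖B (e - 1)‖ := by
      rw [norm_mul]
      have := Complex.norm_exp_sub_one_le (x := c) (hcn.trans hδ1)
      nlinarith [norm_nonneg (B (e - 1)), norm_nonneg (exp c - 1)]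
    have := (Complex.abs_re_le_norm (B (e - 1) * (exp c - 1))).trans hbd
    linarith [neg_abs_le (B (e - 1) * (exp c - 1)).re]
  -- the lower terms
  have hlow : -(3 * ∑ i ∈ Finset.range (e - 1), ‖B i‖) ≤
      (∑ i ∈ Finset.range (e - 1), B i * exp ((((i : ℕ) : ℂ) + 1) * v / (e₀ : ℂ))).re := by
    have hn : ‖∑ i ∈ Finset.range (e - 1), B i * exp ((((i : ℕ) : ℂ) + 1) * v / (e₀ : ℂ))‖ ≤
        3 * ∑ i ∈ Finset.range (e - 1), ‖B i‖ := by
      rw [Finset.mul_sum]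
      refine (norm_sum_le _ _).trans (Finset.sum_le_sum fun i hi => ?_)
      have hi' : i < e - 1 := Finset.mem_range.1 hi
      rw [norm_mul]
      have hexp : ‖exp ((((i : ℕ) : ℂ) + 1) * v / (e₀ : ℂ))‖ ≤ 3 := by
        rw [Complex.norm_exp]
        have hre : ((((i : ℕ) : ℂ) + 1) * v / (e₀ : ℂ)).re ≤ 1 := by
          refine (Complex.re_le_norm _).trans ?_
          rw [mul_div_right_comm, norm_mul]
          have h1 : ‖(((i : ℕ) : ℂ) + 1) / (e₀ : ℂ)‖ ≤ 1 := by
            rw [norm_div, show (((i : ℕ) : ℂ) + 1) = ((i + 1 : ℕ) : ℂ) by push_cast; ring,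
              Complex.norm_natCast, Complex.norm_natCast, div_le_one he₀pos]
            exact_mod_cast (by omega : i + 1 ≤ e₀)
          calc _ ≤ 1 * 1 := mul_le_mul h1 hv1 (norm_nonneg _) zero_le_one
            _ = 1 := one_mul _
        calc Real.exp _ ≤ Real.exp 1 := Real.exp_le_exp.2 hre
          _ ≤ 3 := by linarith [Real.exp_one_lt_d9]
      nlinarith [norm_nonneg (B i), norm_nonneg (exp ((((i : ℕ) : ℂ) + 1) * v / (e₀ : ℂ)))]
    have := (Complex.abs_re_le_norm _).trans hn
    linarith [neg_abs_le (∑ i ∈ Finset.range (e - 1), B i * exp ((((i : ℕ) : ℂ) + 1) * v / (e₀ : ℂ))).re]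
  linarith

/-- **`e^{−W}` on a region with `Re W ≥ M`, `‖W′‖ ≤ B`**: bounded by `e^{−M}` and
`Be^{−M}`-Lipschitz (mean value inequality). [folklore] -/
theorem norm_exp_neg_sub_le {W W' : ℂ → ℂ} {s : Set ℂ} (hs : Convex ℝ s)
    (hW : ∀ v ∈ s, HasDerivAt W (W' v) v) {M B : ℝ} (hM : ∀ v ∈ s, M ≤ (W v).re)
    (hB : ∀ v ∈ s, ‖W' v‖ ≤ B) :
    (∀ v ∈ s, ‖exp (-W v)‖ ≤ Real.exp (-M)) ∧
      ∀ v ∈ s, ∀ v' ∈ s, ‖exp (-W v) - exp (-W v')‖ ≤ B * Real.exp (-M) * ‖v - v'‖ := by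
  have hnorm : ∀ v ∈ s, ‖exp (-W v)‖ ≤ Real.exp (-M) := by
    intro v hv
    rw [Complex.norm_exp, Complex.neg_re]
    exact Real.exp_le_exp.2 (neg_le_neg (hM v hv))
  refine ⟨hnorm, fun v hv v' hv' => ?_⟩
  have hderiv : ∀ u ∈ s, HasDerivAt (fun u => exp (-W u)) (exp (-W u) * -W' u) u :=
    fun u hu => (hW u hu).neg.cexp
  have hbound : ∀ u ∈ s, ‖exp (-W u) * -W' u‖ ≤ B * Real.exp (-M) := by
    intro u hu
    rw [norm_mul, norm_neg]
    calc ‖exp (-W u)‖ * ‖W' u‖ ≤ Real.exp (-M) * B :=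
          mul_le_mul (hnorm u hu) (hB u hu) (norm_nonneg _) (Real.exp_pos _).le
      _ = B * Real.exp (-M) := mul_comm _ _
  have := hs.norm_image_sub_le_of_norm_hasDerivWithin_le
    (fun u hu => (hderiv u hu).hasDerivWithinAt) hbound hv' hv
  exact this

end ExpSum

end Summit.Schanuel.Schanuel.Theorems

end
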